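import Summits.QuantumAdvantage.QuantumAdvantage.Theorems.CubicForrelationNearExactIsExactTwelveTypeO768Bound
import Summits.QuantumAdvantage.QuantumAdvantage.Theorems.CubicForrelationNearExactIsExactTwelveTypeO512
import Summits.QuantumAdvantage.QuantumAdvantage.Theorems.CubicForrelationNearExactIsExactTwelveWeight784None

/-!
# Crux `CubicForrelation.NearExactIsExact` (stmt-QuantumAdvantage-14043) — n = 12: a TYPE-O side has `Φ ≤ 942/1024`

Certificate seat `b2b-cforr-cert` (gen 15).  HONEST FRAMING: a kernel-checked lemma (standard axioms) about cubic Boolean pairs on 12 bits —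
it closes the type-O branch at the top open value `943/1024` of `θ₁₂` (the level-≥6 branch there is still open, so NO new value of `θ₁₂`
is claimed).  NOT summit progress.

* `to15_deriv_values`: for a cubic support `E` on 12 bits with `768 < #E < 896`, `#(E ∩ (E ⊕ a)) ∈ {#E − 768, #E − 512, #E}` for every `a`
  (the derivative `c ⊕ c(·⊕a)` is quadratic with Walsh value `4096 − 4#E + 4#(E ∩ (E⊕a)) > 512` at `0`, and quadratic spectra are plateaued).
* `to15_weight_gap16`: hence `Σ_a #(E ∩ (E ⊕ a)) = #E²` is `≡ 4096·#E ≡ 0 (mod 256)`, i.e. `16 ∣ #E`.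
* `to15_typeO_le_942`: a type-O side (`W_g = 16u`, some `u` odd) has `Φ ≤ 942/1024`: otherwise `2¹⁷(1 − Φ) < 10496` bounds the base energy
  `4096 + 8#E`, so `#E < 800`; `#E ≥ 768` (`to15_typeO_E_ge_768`), `#E ≠ 768` (`to15_typeO_E768_le`), `16 ∣ #E` give `#E = 784`, excluded by
  `to15_weight784_none`.

References: Kasami–Tokura (1970); MacWilliams–Sloane (1977) Ch. 15; Carlet (2021) §5; O'Donnell (2014) §3.3.  Axioms: standard.
-/

set_option linter.dupNamespace false -- D-0017: single-problem summit ⇒ `QuantumAdvantage.QuantumAdvantage` by design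

noncomputable section

namespace Summit.QuantumAdvantage.QuantumAdvantage.Theorems.CubicForrelation.NearExactIsExact

open Finset
open Literature.Computability.QuantumComplexity
open Literature.Computability.QuantumComplexity.BuzetChailloux (bxor zeroVec bxor_bxor_cancel_left bxor_zeroVec zeroVec_bxor bxor_comm
  bxor_self twist_zeroVec_right twist_bxor_right)
open Literature.Computability.QuantumComplexity.DerivativeWalsh (W twist_bxor_left)
open Summit.QuantumAdvantage.QuantumAdvantage.Theorems.NearExactIsExact.Negative (TypeOTwelve.typeO_of_exists_odd)

/-! ### Derivative intersections of a cubic support of size in `(768, 896)` -/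

/-- **Derivative intersections.**  For a cubic `c` on 12 bits with `768 < #E < 896`, `E = {c = 1}`: `#(E ∩ (E ⊕ a)) ∈ {#E − 768, #E − 512, #E}`
(the quadratic `c ⊕ c(·⊕a)` has Walsh value `4096 − 4#E + 4#(E ∩ (E⊕a)) ∈ (512, 4096]` at `0`; `stub_quadWalshPlateau`). [this work] -/
theorem to15_deriv_values (c : (Fin (6 + 6) → Bool) → Bool) (hc : IsDegLeFun 3 c)
    (h1 : 768 < #(univ.filter fun x => c x = true)) (h2 : #(univ.filter fun x => c x = true) < 896) (a : Fin (6 + 6) → Bool) :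
    #((univ.filter fun x => c x = true).filter fun x => bxor x a ∈ univ.filter fun x => c x = true) =
        #(univ.filter fun x => c x = true) - 768 ∨
      #((univ.filter fun x => c x = true).filter fun x => bxor x a ∈ univ.filter fun x => c x = true) =
        #(univ.filter fun x => c x = true) - 512 ∨
      #((univ.filter fun x => c x = true).filter fun x => bxor x a ∈ univ.filter fun x => c x = true) =
        #(univ.filter fun x => c x = true) := by
  classical
  set S := univ.filter (fun x : Fin (6 + 6) → Bool => c x = true) with hSdef
  have hmemS : ∀ x, x ∈ S ↔ c x = true := fun x => by simp [hSdef]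
  set I := #(S.filter fun x => bxor x a ∈ S) with hIdef
  have hIle : I ≤ #S := card_filter_le _ _
  have hind : ∀ x, signOf (c x) = 1 - 2 * (if x ∈ S then (1 : ℝ) else 0) := by
    intro x
    by_cases hx : x ∈ S
    · rw [if_pos hx]; have hc' := (hmemS x).1 hx; unfold signOf; rw [if_pos hc']; norm_num
    · rw [if_neg hx]
      have hc' : ¬ c x = true := fun h => hx ((hmemS x).2 h)
      unfold signOf; rw [if_neg hc']; norm_num
  have hD : IsDegLeFun 2 (fun x => c x ^^ c (bxor x a)) := stub_derivDegree (6 + 6) 2 c a hc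
  obtain ⟨s, hs⟩ := stub_quadWalshPlateau (6 + 6) _ hD
  have hW0 : W (fun x => signOf (c x ^^ c (bxor x a))) zeroVec = 4096 - 4 * (#S : ℝ) + 4 * (I : ℝ) := by
    unfold W
    simp_rw [twist_zeroVec_right, mul_one, signOf_xor]
    rw [sum_congr rfl fun x _ => by rw [hind x, hind (bxor x a)]]
    have e1 : ∀ x : Fin (6 + 6) → Bool, (1 - 2 * (if x ∈ S then (1 : ℝ) else 0)) * (1 - 2 * (if bxor x a ∈ S then (1 : ℝ) else 0)) =
        1 - 2 * (if x ∈ S then (1 : ℝ) else 0) - 2 * (if bxor x a ∈ S then (1 : ℝ) else 0) +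
          4 * (if (x ∈ S ∧ bxor x a ∈ S) then (1 : ℝ) else 0) := by
      intro x; by_cases h1 : x ∈ S <;> by_cases h2 : bxor x a ∈ S <;> norm_num [h1, h2]
    rw [sum_congr rfl fun x _ => e1 x, sum_add_distrib, sum_sub_distrib, sum_sub_distrib, sum_const, card_univ, Fintype.card_fun,
      Fintype.card_bool, Fintype.card_fin, ← mul_sum, ← mul_sum, ← mul_sum, sum_boole, sum_boole, sum_boole]
    have c1 : #(univ.filter fun x : Fin (6 + 6) → Bool => x ∈ S) = #S := by
      rw [show (univ.filter fun x : Fin (6 + 6) → Bool => x ∈ S) = S by ext x; simp]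
    have c2 : #(univ.filter fun x : Fin (6 + 6) → Bool => bxor x a ∈ S) = #S := by
      refine card_nbij' (fun x => bxor x a) (fun x => bxor x a) (fun x hx => ?_) (fun x hx => ?_)
        (fun x _ => by show bxor (bxor x a) a = x; rw [iw_bxor_assoc, bxor_self, bxor_zeroVec])
        (fun x _ => by show bxor (bxor x a) a = x; rw [iw_bxor_assoc, bxor_self, bxor_zeroVec])
      · rw [mem_coe, mem_filter] at hx; exact hx.2
      · rw [mem_coe] at hx; rw [mem_coe, mem_filter, iw_bxor_assoc, bxor_self, bxor_zeroVec]; exact ⟨mem_univ _, hx⟩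
    have c3 : #(univ.filter fun x : Fin (6 + 6) → Bool => x ∈ S ∧ bxor x a ∈ S) = I := by
      simp only [I]; congr 1; ext x; simp
    rw [c1, c2, c3]
    norm_num; ring
  have hS1 : (768 : ℝ) < #S := by exact_mod_cast h1
  have hS2 : (#S : ℝ) < 896 := by exact_mod_cast h2
  have hIle' : (I : ℝ) ≤ #S := by exact_mod_cast hIle
  rcases hs zeroVec with h0 | hsq
  · exfalso
    rw [hW0] at h0
    have : (0 : ℝ) ≤ I := by positivity
    linarith
  · rw [hW0] at hsq
    have h4 : (4 : ℝ) ^ s = ((2 : ℝ) ^ s) ^ 2 := by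
      rw [show (4 : ℝ) = 2 ^ 2 by norm_num, ← pow_mul, mul_comm, pow_mul]
    rw [h4] at hsq
    have hpos : (0 : ℝ) ≤ 4096 - 4 * (#S : ℝ) + 4 * (I : ℝ) := by
      have : (0 : ℝ) ≤ I := by positivity
      linarith
    have h2s : 4096 - 4 * (#S : ℝ) + 4 * (I : ℝ) = (2 : ℝ) ^ s :=
      (pow_left_inj₀ hpos (by positivity) (by norm_num : (2 : ℕ) ≠ 0)).1 hsq
    have hs_le : s ≤ 12 := by
      by_contra h
      push Not at h
      have : (2 : ℝ) ^ 13 ≤ 2 ^ s := pow_le_pow_right₀ (by norm_num) h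
      norm_num at this; linarith
    have hs_ge : 10 ≤ s := by
      by_contra h
      push Not at h
      have h29 : (2 : ℝ) ^ s ≤ 2 ^ 9 := pow_le_pow_right₀ (by norm_num) (by omega)
      have hI0 : (0 : ℝ) ≤ I := by positivity
      norm_num at h29
      linarith
    interval_cases s
    · left
      have h' : (I : ℝ) = #S - 768 := by rw [show (2 : ℝ) ^ 10 = 1024 by norm_num] at h2s; linarith
      have h'' : ((I : ℕ) : ℝ) = ((#S - 768 : ℕ) : ℝ) := by rw [h']; push_cast [h1.le]; ring
      exact_mod_cast h''
    · right; left
      have h' : (I : ℝ) = #S - 512 := by rw [show (2 : ℝ) ^ 11 = 2048 by norm_num] at h2s; linarith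
      have h'' : ((I : ℕ) : ℝ) = ((#S - 512 : ℕ) : ℝ) := by rw [h']; push_cast [show 512 ≤ #S by omega]; ring
      exact_mod_cast h''
    · right; right
      have h' : (I : ℝ) = #S := by rw [show (2 : ℝ) ^ 12 = 4096 by norm_num] at h2s; linarith
      exact_mod_cast h'

/-- **`16 ∣ #E` for a cubic support of size in `(768, 896)`** (`Σ_a #(E ∩ (E ⊕ a)) = #E²` and `to15_deriv_values` mod `256`). [this work] -/
theorem to15_weight_gap16 (c : (Fin (6 + 6) → Bool) → Bool) (hc : IsDegLeFun 3 c)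
    (h1 : 768 < #(univ.filter fun x => c x = true)) (h2 : #(univ.filter fun x => c x = true) < 896) :
    16 ∣ #(univ.filter fun x => c x = true) := by
  classical
  set S := univ.filter (fun x : Fin (6 + 6) → Bool => c x = true) with hSdef
  set I : (Fin (6 + 6) → Bool) → ℕ := fun a => #(S.filter fun x => bxor x a ∈ S) with hIdef
  have hIval : ∀ a, I a = #S - 768 ∨ I a = #S - 512 ∨ I a = #S := fun a => to15_deriv_values c hc h1 h2 a
  -- `Σ_a I(a) = #S²` by counting `S × S` along `(x, y) ↦ x ⊕ y`
  set P2 := S ×ˢ S with hP2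
  have hJI : ∀ a, #(P2.filter fun q => bxor q.1 q.2 = a) = I a := by
    intro a
    simp only [I]
    refine card_nbij' (fun q => q.1) (fun x => (x, bxor x a)) (fun q hq => ?_) (fun x hx => ?_) (fun q hq => ?_) (fun x _ => rfl)
    · rw [mem_coe, mem_filter, hP2, mem_product] at hq
      rw [mem_coe, mem_filter]
      refine ⟨hq.1.1, ?_⟩
      rw [← hq.2, bxor_bxor_cancel_left]; exact hq.1.2
    · rw [mem_coe, mem_filter] at hx
      rw [mem_coe, mem_filter, hP2, mem_product]
      exact ⟨⟨hx.1, hx.2⟩, bxor_bxor_cancel_left _ _⟩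
    · rw [mem_coe, mem_filter] at hq
      obtain ⟨-, h⟩ := hq
      show (q.1, bxor q.1 a) = q
      rw [← h, bxor_bxor_cancel_left]
  have hsum : #S * #S = ∑ a, I a := by
    have h := card_eq_sum_card_fiberwise (s := P2) (t := (univ : Finset (Fin (6 + 6) → Bool))) (f := fun q => bxor q.1 q.2)
      (fun q _ => mem_univ _)
    rw [hP2, card_product] at h
    rw [h]
    exact sum_congr rfl fun a _ => hJI a
  have hmod : ∀ a, I a % 256 = #S % 256 := by
    intro a; rcases hIval a with h | h | h <;> rw [h] <;> omega
  have hsq : (#S * #S) % 256 = 0 := by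
    rw [hsum, sum_nat_mod, sum_congr rfl fun a _ => hmod a, sum_const, card_univ, Fintype.card_fun, Fintype.card_bool,
      Fintype.card_fin, smul_eq_mul]
    norm_num
    omega
  have h16 : 16 ^ 2 ∣ #S ^ 2 := by
    rw [sq, sq]
    exact Nat.dvd_of_mod_eq_zero hsq
  exact (Nat.pow_dvd_pow_iff two_ne_zero).1 h16

/-! ### The type-O ceiling `942/1024` -/

/-- **A type-O side has `Φ ≤ 942/1024` (12 bits).**  Cubic `f, g : 𝔽₂¹² → 𝔽₂` with `W_g = 16u` and some `u(x)` odd: `Φ(f,g) ≤ 942/1024`.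
(Above it the base energy `4096 + 8#E ≤ 2¹⁷(1 − Φ) < 10496` forces `#E < 800`; with `#E ≥ 768`, `#E ≠ 768`, `16 ∣ #E` this is `#E = 784`, and
no cubic has weight `784`.)  The level-≥6 branch at `943/1024` is NOT treated here.  Finite-slice statement; NOT summit progress. [this work] -/
theorem to15_typeO_le_942 (f g : (Fin (6 + 6) → Bool) → Bool) (hf : IsDegLeFun 3 f) (hg : IsDegLeFun 3 g)
    (u : (Fin (6 + 6) → Bool) → ℤ) (hu : ∀ x, W (fun y => signOf (g y)) x = (2 : ℝ) ^ 4 * (u x : ℝ))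
    (hodd : ∃ x, Odd (u x)) : forrelation f g ≤ 942 / 1024 := by
  classical
  by_contra hΦ
  push Not at hΦ
  have hall : ∀ x, Odd (u x) := TypeOTwelve.typeO_of_exists_odd g u hg hu hodd
  have hu' : ∀ x, W (fun y => signOf (g y)) x = (2 : ℝ) ^ (2 * 2) * (u x : ℝ) := fun x => (hu x).trans (by norm_num)
  have hd1 : IsDegLeFun 1 (fun x => decide (Odd (u x / 2))) := z2_digitOne 2 g u hg hu' hall
  have hd2 : IsDegLeFun 3 (fun x => decide (Odd (u x / 2 / 2))) := z2_digitTwo 2 g u hg hu' hall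
  set E := univ.filter (fun x : Fin (6 + 6) → Bool => (Odd (u x / 2) ↔ Odd (u x / 2 / 2))) with hEdef
  have hdegE : IsDegLeFun (2 + 1) (fun x => (decide (Odd (u x / 2)) ^^ decide (Odd (u x / 2 / 2))) ^^ true) :=
    tb_isDegLeFun_xor_const (bb_isDegLeFun_bxor (hd1.mono (by norm_num)) hd2) true
  have hsetE : (univ.filter fun x : Fin (6 + 6) → Bool =>
      ((decide (Odd (u x / 2)) ^^ decide (Odd (u x / 2 / 2))) ^^ true) = true) = E := by
    rw [hEdef]
    apply filter_congr
    intro x _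
    by_cases h1 : Odd (u x / 2) <;> by_cases h2 : Odd (u x / 2 / 2) <;> simp [h1, h2]
  have hsumE : (∑ x, (if (Odd (u x / 2) ↔ Odd (u x / 2 / 2)) then 1 else 0 : ℤ)) = #E := by rw [sum_boole]
  -- `#E ≥ 768`, `#E ≠ 768`
  have hE768 : 768 ≤ #E := to15_typeO_E_ge_768 f g hf hg u hu hodd (by linarith)
  have hEne : #E ≠ 768 := by
    intro h
    have := to15_typeO_E768_le f g hf hg u hu hodd h
    linarith
  -- budget: `4096 + 8#E ≤ Σ τ² = 2¹⁷(1 − Φ) < 10496`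
  have hbud := tw12_budget f g u hu
  have hT : (∑ x, (u x - 4 * sZ (f x)) ^ 2 : ℤ) ≤ 10495 := by
    have h' : ((∑ x, (u x - 4 * sZ (f x)) ^ 2 : ℤ) : ℝ) < 10496 := by rw [hbud]; linarith
    have h'' : (∑ x, (u x - 4 * sZ (f x)) ^ 2 : ℤ) < 10496 := by exact_mod_cast h'
    omega
  choose v hv using fun x => to12_pt_mod8 (u x) (sZ (f x)) (hall x) (tp_sZ_cases (f x))
  set τ₀ : (Fin (6 + 6) → Bool) → ℤ := fun x =>
    sZ (decide (Odd (u x / 2))) * (1 - 4 * (if (Odd (u x / 2) ↔ Odd (u x / 2 / 2)) then 1 else 0)) with hτ₀def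
  have hvx : ∀ x, u x - 4 * sZ (f x) = τ₀ x + 8 * v x := fun x => hv x
  have hτ₀val : ∀ x, τ₀ x = 1 ∨ τ₀ x = -1 ∨ τ₀ x = 3 ∨ τ₀ x = -3 := by
    intro x
    simp only [τ₀]
    rcases tp_sZ_cases (decide (Odd (u x / 2))) with h | h <;> rw [h] <;> split_ifs <;> norm_num
  have hτ₀sq : ∀ x, τ₀ x ^ 2 = 1 + 8 * (if (Odd (u x / 2) ↔ Odd (u x / 2 / 2)) then 1 else 0 : ℤ) := by
    intro x
    simp only [τ₀]
    rcases tp_sZ_cases (decide (Odd (u x / 2))) with h | h <;> rw [h] <;> split_ifs <;> norm_num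
  have hsumτ₀ : ∑ x, τ₀ x ^ 2 = 4096 + 8 * #E := by
    rw [sum_congr rfl fun x _ => hτ₀sq x, sum_add_distrib, ← mul_sum, hsumE, sum_const, card_univ, Fintype.card_fun,
      Fintype.card_bool, Fintype.card_fin]
    norm_num
  set X : (Fin (6 + 6) → Bool) → ℤ := fun x => (τ₀ x + 8 * v x) ^ 2 - τ₀ x ^ 2 with hXdef
  have hXnn : ∀ x, 0 ≤ X x := fun x => to12_excess_nonneg _ _ (hτ₀val x)
  have hTdec : (∑ x, (u x - 4 * sZ (f x)) ^ 2 : ℤ) = ∑ x, τ₀ x ^ 2 + ∑ x, X x := by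
    rw [← sum_add_distrib]
    exact sum_congr rfl fun x _ => by rw [hvx x]; simp only [X]; ring
  have hXsum_nn : 0 ≤ ∑ x, X x := sum_nonneg fun x _ => hXnn x
  have hE800 : #E < 800 := by
    rw [hTdec, hsumτ₀] at hT
    have : (8 : ℤ) * #E ≤ 6399 := by linarith
    have : 8 * #E ≤ 6399 := by exact_mod_cast this
    omega
  -- `16 ∣ #E`, so `#E = 784`
  have h16 : 16 ∣ #E := by
    have h := to15_weight_gap16 _ hdegE (by rw [hsetE]; omega) (by rw [hsetE]; omega)
    rwa [hsetE] at h
  have hE784 : #E = 784 := by omega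
  exact to15_weight784_none _ hdegE (by rw [hsetE, hE784])

end Summit.QuantumAdvantage.QuantumAdvantage.Theorems.CubicForrelation.NearExactIsExact

end
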